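import Literature.Probability.Percolation.TriangularIsoradialTiling
import Literature.Probability.Percolation.TriangularBoxCrossingProofs
import Literature.Probability.Percolation.IsoradialBoxCrossingGM
import Literature.Probability.LatticeModels.TriangularSquareGrid
import HarnessLib

/-!
# Critical bond percolation on `𝕋`: the box-crossing fact from `gm_boxCrossing` and the square-grid property alone

Topic `Literature/Probability/Percolation`; theorems only. Final glue between the named fact
`GrimmettManolescuAOP2013_triangular_boxCrossing` (`TriangularBoxCrossing`: critical bond
percolation `bondPercolation triGraph (criticalWeightI (π/6))` has the box-crossing property in
every drawing `s • triEmbed`, `0 < s ≤ 2`; Grimmett–Manolescu, Ann. Probab. 41 (2013), §1.3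
main Theorem (b), homogeneous case) and the tree fact `gm_boxCrossing` (Grimmett–Manolescu, PTRF
159 (2014), Thm 1.1(a) = §3 Thm 3.1: "For `G ∈ 𝒢`, `P_G` possesses the box-crossing property"),
now that the triangular lattice has been realised as an isoradial rhombic tiling
(`triIsoradialEmbedding`: `TriangularIsoradialEmbedding`, `TriangularIsoradialTiling`):
`GrimmettManolescuAOP2013_triangular_boxCrossing_of_gm_boxCrossing`
(`TriangularBoxCrossingProofs`) applies with every structural hypothesis discharged — drawing
`√3 · triEmbed − √3 (1 + ζ)/3` (`t = √3 ≤ 2`), canonical law, isoradiality, rhombic tiling,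
BAP(`π/6`) — except the printed square-grid property `HasSquareGridPropertyGM` (§4.2 of the
2014 paper: two of the three parallel track families of the rhombille tiling as the grid, the
third crossing both in order), which is left as the hypothesis `hsgp`.

## Update (square-grid property discharged)

With `Literature.Probability.LatticeModels.TriangularSquareGrid`
(`hasSquareGridPropertyGM_triIsoradialEmbedding`: the rhombille tiling has SGP(2), its track
system being the three parallel families of row, column and antidiagonal tracks — GM 2014,
§4.3.2) the hypothesis `hsgp` is discharged:
`GrimmettManolescuAOP2013_triangular_boxCrossing_of_gm_boxCrossing_triangular` derives the fact
from `gm_boxCrossing triGraph triIsoradialEmbedding (π/6)` alone, and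
`GrimmettManolescuAOP2013_triangular_boxCrossing_of_gm_boxCrossingBounds_uniform` from the
uniform fact `gm_boxCrossingBounds_uniform` (GM 2014, (3.1)) alone, `𝕋` living on a type in
`Type` (`hasBoxCrossingProperty_of_gm_boxCrossingBounds_uniform_of_hasSquareGridPropertyGM`).
What separates the fact from a proof is now exactly the isoradial box-crossing theorem
(GM 2014, §3 Thm 3.1; tree facts `gm_boxCrossing`, `gm_boxCrossingBounds_uniform`).

## References

* G. R. Grimmett, I. Manolescu, PTRF 159 (2014) 273–327, arXiv:1204.0505, §3 Thm 3.1, §4.2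
  (SGP(I)), §1 (`𝒢` includes the triangular lattice).
* G. R. Grimmett, I. Manolescu, Ann. Probab. 41 (2013) 2990–3025, arXiv:1105.5535, §1.3 Thm 3(b).
-/

noncomputable section

namespace Literature.Probability.Percolation

open Literature.Probability.LatticeModels

/-- **Critical bond percolation on `𝕋` has the box-crossing property as soon as
`gm_boxCrossing` holds for `𝕋` and `𝕋` has the printed square-grid property**: all other
hypotheses of `GrimmettManolescuAOP2013_triangular_boxCrossing_of_gm_boxCrossing` are discharged
by `triIsoradialEmbedding` — the drawing `√3 · triEmbed − √3 (1 + ζ)/3` (`t = √3 ≤ 2`), the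
canonical law `bondPercolation triGraph (criticalWeightI (π/6))`, isoradiality, the rhombic
tiling (`TriangularIsoradialTiling`) and BAP(`π/6`). (Grimmett–Manolescu 2014, §3 Thm 3.1 for `𝕋 ∈ 𝒢`;
Grimmett–Manolescu 2013, §1.3 Thm 3(b), homogeneous case.)
[cite: GrimmettManolescu2014Isoradial, §3 Thm 3.1 (𝒢 ∋ 𝕋, §1); GrimmettManolescuAOP2013 §1.3 Thm 3(b)] -/
theorem GrimmettManolescuAOP2013_triangular_boxCrossing_of_gm_boxCrossing_tri
    (hsgp : triIsoradialEmbedding.HasSquareGridPropertyGM)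
    (h : gm_boxCrossing triGraph triIsoradialEmbedding (Real.pi / 6)) :
    GrimmettManolescuAOP2013_triangular_boxCrossing := by
  have h3 : (0 : ℝ) < Real.sqrt 3 := Real.sqrt_pos.mpr (by norm_num)
  have h32 : Real.sqrt 3 ≤ 2 := by
    rw [show (2 : ℝ) = Real.sqrt (2 ^ 2) by rw [Real.sqrt_sq (by norm_num)]]
    exact Real.sqrt_le_sqrt (by norm_num)
  exact GrimmettManolescuAOP2013_triangular_boxCrossing_of_gm_boxCrossing triIsoradialEmbedding
    h3 h32 ((Real.sqrt 3 : ℂ) * ((1 + triZeta) / 3)) (fun x => by rw [triIsoradialEmbedding_z]; ring)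
    triIsoradialEmbedding_isoradialPercolation triIsoradialEmbedding_isIsoradial
    triIsoradialEmbedding_isRhombicTiling (by positivity) triIsoradialEmbedding_hasBoundedAngles
    hsgp h

/-- **Critical bond percolation on `𝕋` has the box-crossing property as soon as `gm_boxCrossing`
holds for the isoradial triangular lattice** — every hypothesis of Grimmett–Manolescu's class `𝒢`
is now discharged for `triIsoradialEmbedding`: isoradiality, rhombic tiling, BAP(`π/6`)
(`TriangularIsoradialEmbedding`, `TriangularIsoradialTiling`) and the printed square-grid
property SGP(2) (`hasSquareGridPropertyGM_triIsoradialEmbedding`, `TriangularSquareGrid`).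
(Grimmett–Manolescu 2014, §3 Thm 3.1 for `𝕋 ∈ 𝒢` (§1, §4.3.2); Grimmett–Manolescu 2013, §1.3
Thm 3(b), homogeneous case.)
[cite: GrimmettManolescu2014Isoradial, §3 Thm 3.1 (𝒢 ∋ 𝕋: §1, §4.3.2); GrimmettManolescuAOP2013 §1.3 Thm 3(b)] -/
theorem GrimmettManolescuAOP2013_triangular_boxCrossing_of_gm_boxCrossing_triangular
    (h : gm_boxCrossing triGraph triIsoradialEmbedding (Real.pi / 6)) :
    GrimmettManolescuAOP2013_triangular_boxCrossing :=
  GrimmettManolescuAOP2013_triangular_boxCrossing_of_gm_boxCrossing_tri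
    hasSquareGridPropertyGM_triIsoradialEmbedding h

/-- **… and as soon as the uniform box-crossing fact `gm_boxCrossingBounds_uniform` (GM 2014,
(3.1)) holds**: `𝕋` lives on a type in `Type`, so the per-graph statement follows from the
uniform one (`hasBoxCrossingProperty_of_gm_boxCrossingBounds_uniform_of_hasSquareGridPropertyGM`).
[cite: GrimmettManolescu2014Isoradial, §3 Thm 3.1 with (3.1); GrimmettManolescuAOP2013 §1.3 Thm 3(b)] -/
theorem GrimmettManolescuAOP2013_triangular_boxCrossing_of_gm_boxCrossingBounds_uniform
    (h : gm_boxCrossingBounds_uniform) : GrimmettManolescuAOP2013_triangular_boxCrossing :=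
  GrimmettManolescuAOP2013_triangular_boxCrossing_of_gm_boxCrossing_triangular
    (hasBoxCrossingProperty_of_gm_boxCrossingBounds_uniform_of_hasSquareGridPropertyGM h triGraph
      triIsoradialEmbedding (Real.pi / 6))

end Literature.Probability.Percolation

end
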